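import Summits.ResolutionOfSingularities.ResolutionOfSingularities.Theorems.PurelyInseparableDim4ResConePowerCone
import Mathlib.LinearAlgebra.Projection
import HarnessLib
import HarnessLib.Audit.Tags

/-!
# Purely inseparable four-folds — A TAME CONE LIVES IN THE ALGEBRA OF THE LINEAR FORMS CUTTING OUT ITS POLAR
# KERNEL: `g ∈ K[ℓ₁, …, ℓ_n]`, `n = 4 − e_G`, for `deg g < p` (every prime; the `e_G = 2` slice is a
# binary-form cone)

[OURS · counted 0 · cell `res-dim4-pi` · seat res-dim4-p-12 g2 · K2(p) lane (desk WORD #66 (2)).]  Nothing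
here proves K2(p), `NoIsolatedTrap p p` or resolution of singularities in dimension ≥ 4 / characteristic `p`.

Sequel of `…ResConePowerCone` (the `e_G = 3` slice `g = c ℓ^d`).  For a form `g` of degree `d < p` and linear
functionals `φ₁, …, φ_n` with a dual family `u₁, …, u_n` (`φ_a(u_b) = δ`) whose common kernel is killed by the
polar map `w ↦ D_w g`:
* `polarMap_polarMap_comm` — polars commute;  `polarMap_eq_sum_of_dual` — `D_w g = Σ_a φ_a(w) · D_{u_a} g`;
* **`mem_adjoin_of_ker_le`** — `g ∈ Algebra.adjoin K {L_a := Σ_i φ_a(e_i) x_i}` (induction on `d` with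
  Euler's identity: `d · g = Σ_a L_a · D_{u_a} g`, and each `D_{u_a} g` inherits the kernel condition);
* **`resForm_mem_adjoin_of_shade_lt`** — for a state with `x^r ∣ F`, `ord₀ F = o`, shade `o − |r| < p`:
  `resForm s ∈ K[L₁, …, L_n]` with `n + e_G = 4` linear forms whose common zero set (on vectors) is EXACTLY
  `resVertex s` (complement + projection + basis coordinates).  At `e_G = 2` this is I-4-8's «`g = B(ℓ₁, ℓ₂)`
  a binary form, `Π = {ℓ₁ = ℓ₂ = 0}`», now kernel for every `p` and `d < p`; false for `d ≥ p`.
bears_on: LADDER-RESOLUTION:D157-DOOR2 (res-dim4-pi · K2(p) · e_G ∈ {2, 3} slices).  Supports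
stmt-ResolutionOfSingularities-16155 (helper).
-/

set_option linter.dupNamespace false -- mandated namespace of this single-conjunct summit

noncomputable section

namespace Summit.ResolutionOfSingularities.ResolutionOfSingularities.Theorems.PIDim4

namespace ResCone

open MvPolynomial Finset
open Literature.AlgebraicGeometry.Resolution
open Literature.AlgebraicGeometry.Resolution.CentreBlowup
open Literature.AlgebraicGeometry.Resolution.Hauser2010
open Literature.AlgebraicGeometry.Resolution.HauserPerlega2019
open PointBlowup (polarMap additiveSubspace direction)

variable {K : Type} [Field K]

/-! ## 1. Polars commute -/

/-- **Polars commute**: `D_w D_u Φ = D_u D_w Φ`. [folklore] -/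
theorem polarMap_polarMap_comm (Φ : MvPolynomial (Fin 4) K) (u w : Fin 4 → K) :
    polarMap (polarMap Φ u) w = polarMap (polarMap Φ w) u := by
  simp only [polarMap_eq_sum_C_mul]
  simp_rw [CampaignW46.TameDirectrix.pderiv_dirDeriv, Finset.mul_sum]
  rw [Finset.sum_comm]
  refine Finset.sum_congr rfl fun i _ => Finset.sum_congr rfl fun j _ => ?_
  rw [Literature.Computability.AlgebraicComplexity.pderiv_pderiv_comm i j]
  ring

/-- The polar of `0` vanishes. [folklore] -/
theorem polarMap_zero_left (w : Fin 4 → K) : polarMap (0 : MvPolynomial (Fin 4) K) w = 0 := by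
  rw [NarrowApolarity.polarMap_apply]
  exact Finset.sum_eq_zero fun i _ => by rw [map_zero, smul_zero]

/-! ## 2. Factorisation through a dual family -/

section Dual

variable {ι : Type} [Fintype ι] [DecidableEq ι]

/-- **Factorisation**: if `D_w g = 0` on the common kernel of `φ₁, …, φ_n` and `u` is a dual family
(`φ_a (u_b) = δ_{ab}`), then `D_w g = Σ_a φ_a(w) · D_{u_a} g`. [folklore] -/
theorem polarMap_eq_sum_of_dual {g : MvPolynomial (Fin 4) K} (φ : ι → (Fin 4 → K) →ₗ[K] K)
    (u : ι → Fin 4 → K) (hdual : ∀ a b, φ a (u b) = if b = a then 1 else 0)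
    (hker : ∀ w : Fin 4 → K, (∀ a, φ a w = 0) → polarMap g w = 0) (w : Fin 4 → K) :
    polarMap g w = ∑ a, φ a w • polarMap g (u a) := by
  have hw' : ∀ b, φ b (w - ∑ a, φ a w • u a) = 0 := by
    intro b
    rw [map_sub, map_sum]
    simp_rw [map_smul, hdual, smul_eq_mul, mul_ite, mul_one, mul_zero]
    rw [Finset.sum_ite_eq' Finset.univ b (fun a => φ a w), if_pos (Finset.mem_univ b), sub_self]
  have hsplit : w = (w - ∑ a, φ a w • u a) + ∑ a, φ a w • u a := (sub_add_cancel _ _).symm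
  conv_lhs => rw [hsplit]
  rw [map_add, hker _ hw', zero_add, map_sum]
  simp_rw [map_smul]

/-- **A TAME FORM LIVES IN THE ALGEBRA OF THE LINEAR FORMS CUTTING OUT ITS POLAR KERNEL**: if `deg g = d < p`
and `D_w g = 0` on the common kernel of `φ₁, …, φ_n` (with a dual family), then
`g ∈ K[L₁, …, L_n]`, `L_a = Σ_i φ_a(e_i) x_i`.  False for `d ≥ p` (`x^p + y^p`). [folklore]
[cite: CossartJannsenSaito2020, Def. 2.8 (directrix of a cone)] -/
theorem mem_adjoin_of_ker_le (p : ℕ) [Fact p.Prime] [CharP K p] (φ : ι → (Fin 4 → K) →ₗ[K] K)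
    (u : ι → Fin 4 → K) (hdual : ∀ a b, φ a (u b) = if b = a then 1 else 0) :
    ∀ (d : ℕ), d < p → ∀ g : MvPolynomial (Fin 4) K, g.IsHomogeneous d →
      (∀ w : Fin 4 → K, (∀ a, φ a w = 0) → polarMap g w = 0) →
      g ∈ Algebra.adjoin K
        (Set.range fun a : ι => ∑ i : Fin 4, C (φ a (Pi.single i 1)) * (X i : MvPolynomial (Fin 4) K)) := by
  intro d
  induction d with
  | zero =>
    intro _ g hg _
    rw [totalDegree_eq_zero_iff_eq_C.mp ((totalDegree_zero_iff_isHomogeneous _).mpr hg),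
      ← MvPolynomial.algebraMap_eq]
    exact Subalgebra.algebraMap_mem _ _
  | succ d ih =>
    intro hdp g hg hker
    -- the polars `D_{u_a} g`: forms of degree `d` with the same kernel condition, hence in the algebra
    have hh : ∀ a, (polarMap g (u a)).IsHomogeneous d := fun a => by
      rw [polarMap_eq_sum_C_mul]
      simpa using CampaignW46.TameDirectrix.isHomogeneous_dirDeriv hg (u a)
    have hkh : ∀ a, ∀ w : Fin 4 → K, (∀ b, φ b w = 0) → polarMap (polarMap g (u a)) w = 0 :=
      fun a w hw => by rw [polarMap_polarMap_comm, hker w hw, polarMap_zero_left]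
    have hmem : ∀ a, polarMap g (u a) ∈ Algebra.adjoin K
        (Set.range fun a : ι => ∑ i : Fin 4, C (φ a (Pi.single i 1)) * (X i : MvPolynomial (Fin 4) K)) :=
      fun a => ih (by omega) _ (hh a) (hkh a)
    -- partials and Euler
    have hpd : ∀ i, pderiv i g = ∑ a, φ a (Pi.single i 1) • polarMap g (u a) := fun i => by
      rw [← polarMap_single, polarMap_eq_sum_of_dual φ u hdual hker]
    have heuler := hg.sum_X_mul_pderiv
    have hsum : ∑ i : Fin 4, X i * pderiv i g =
        ∑ a, (∑ i : Fin 4, C (φ a (Pi.single i 1)) * X i) * polarMap g (u a) := by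
      simp_rw [hpd, Finset.mul_sum, Finset.sum_mul]
      rw [Finset.sum_comm]
      refine Finset.sum_congr rfl fun a _ => Finset.sum_congr rfl fun i _ => ?_
      rw [← MvPolynomial.C_mul']
      ring
    have hn : ((d + 1 : ℕ) : K) ≠ 0 := natCast_ne_zero_of_lt p (Nat.succ_pos d) hdp
    have hg' : g = ((d + 1 : ℕ) : K)⁻¹ •
        ∑ a, (∑ i : Fin 4, C (φ a (Pi.single i 1)) * X i) * polarMap g (u a) := by
      rw [← hsum, heuler, ← Nat.cast_smul_eq_nsmul K, inv_smul_smul₀ hn]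
    rw [hg']
    refine Subalgebra.smul_mem _ (sum_mem fun a _ => mul_mem ?_ (hmem a)) _
    exact Algebra.subset_adjoin ⟨a, rfl⟩

end Dual

/-! ## 3. The residual cone: `resForm s ∈ K[L₁, …, L_{4 − e_G}]` for shade `< p` -/

/-- **THE TAME RESIDUAL CONE LIVES IN THE ALGEBRA OF `4 − e_G` LINEAR FORMS** whose common zero set is
exactly the polar kernel: for a state with `x^r ∣ F`, `ord₀ F = o` and shade `o − |r| < p` there are
`n = 4 − finrank (resVertex s)` linear functionals `φ_a` with `resVertex s = ⋂ ker φ_a` and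
`resForm s ∈ Algebra.adjoin K {Σ_i φ_a(e_i) x_i}`.  At `e_G = 2`: a BINARY-FORM cone `B(ℓ₁, ℓ₂)` (I-4-8);
at `e_G = 3`: `c ℓ^d` (`…PowerCone`). [OURS] [cite: CossartJannsenSaito2020, Def. 2.8 (directrix of a cone)] -/
theorem resForm_mem_adjoin_of_shade_lt (p : ℕ) [Fact p.Prime] [CharP K p] {s : State K} {o : ℕ}
    (ho : ordZero s.F = o) (hd : o - s.r.degree < p) :
    ∃ (n : ℕ) (φ : Fin n → (Fin 4 → K) →ₗ[K] K),
      n + Module.finrank K (resVertex s) = 4 ∧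
      (∀ w, w ∈ resVertex s ↔ ∀ a, φ a w = 0) ∧
      resForm s ∈ Algebra.adjoin K
        (Set.range fun a => ∑ i : Fin 4, C (φ a (Pi.single i 1)) * (X i : MvPolynomial (Fin 4) K)) := by
  obtain ⟨W', hc⟩ := Submodule.exists_isCompl (resVertex s)
  let b := Module.finBasis K W'
  let π := Submodule.projectionOnto W' (resVertex s) hc.symm
  have hiff : ∀ w, w ∈ resVertex s ↔ ∀ a, ((b.coord a) ∘ₗ π) w = 0 := by
    intro w
    constructor
    · intro hw a
      rw [LinearMap.comp_apply, (Submodule.projectionOnto_apply_eq_zero_iff hc.symm).mpr hw, map_zero]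
    · intro h
      have hπ : π w = 0 :=
        b.forall_coord_eq_zero_iff.mp fun a => by simpa only [LinearMap.comp_apply] using h a
      exact (Submodule.projectionOnto_apply_eq_zero_iff hc.symm).mp hπ
  refine ⟨Module.finrank K W', fun a => (b.coord a) ∘ₗ π, ?_, hiff, ?_⟩
  · have h := Submodule.finrank_add_eq_of_isCompl hc
    rw [Module.finrank_fin_fun] at h
    omega
  · refine mem_adjoin_of_ker_le p (fun a => (b.coord a) ∘ₗ π) (fun a => (b a : Fin 4 → K)) ?_ _ hd _
      (resForm_isHomogeneous ho) ?_
    · intro a c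
      rw [LinearMap.comp_apply, Submodule.projectionOnto_apply_left, b.coord_apply, b.repr_self_apply]
    · intro w hw
      have hmemw : w ∈ resVertex s := (hiff w).mpr hw
      unfold resVertex additiveSubspace at hmemw
      exact LinearMap.mem_ker.mp hmemw

end ResCone

end Summit.ResolutionOfSingularities.ResolutionOfSingularities.Theorems.PIDim4

end
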